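import Summits.QuantumFields.YangMills.Theorems.SwapVirialDeficitQuantitativeLaplaceSkewProductChart
import HarnessLib

/-!
# Route `SwapVirialDeficit` (YangMills): quantitative Laplace method — RESTRICTING A CHART IDENTITY, skew product over an arbitrary window

Width seat `ym-line-sfw-p2-w2` g58 (cell ym-idea-1, free hands), `--supports stmt-QuantumFields-24197`; generic measure theory serving the
window-uniform («Morse–Bott ∕ fibred Laplace») road to `SwapGluedStiffness` (LEAD g97 plan W3–W9).  The tree's one-group exponential chart
identity ✓`haar_restrict_window_eq_map_withDensity_frame` (`Literature/Analysis/Asymptotics/LaplaceMethodCompactGroup`) is stated on the FRAME BALL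
`e⁻¹B(0, s_C∕2)`, while the fibred cores ✓`laplaceMethod_quantitative_fibred[_cubic]` integrate over the Euclidean window `B̄(0,R)` of the frame space and
✓`skewChart_restrict_image_eq_map` asks for the one-fibre identity on exactly that window.  This file supplies the two reformatting steps, so that the
consumer's chain is BY NAME: frame identity ⟶ (§1) identity on `B̄(0,R) ⊆ e⁻¹B` ⟶ (§2 ∕ ✓skew product) tube identity ⟶ ✓`laplaceMethod_chart_of_tube`.

* §1 ★★ `chartIdentity_restrict` — if `κ|_{E(D)} = E_*((J·vol)|_D)` with `E` injective on `D`, then for every `S ⊆ D` with `E(S)` measurable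
  `κ|_{E(S)} = E_*((J·vol)|_S)` (arbitrary measures `vol` on `V`, `κ` on `Y`, density `J : V → ℝ≥0∞`).
* §2 ★★ `skewChart_restrict_image_eq_map_of_measurableSet` — ✓`skewChart_restrict_image_eq_map` with the fibre window `B̄(0,R)` replaced by an arbitrary
  measurable `B ⊆ V` (same proof; the closed-ball version is the special case): `(ν ⊗ κ)|_{Ψ(M × B)} = Ψ_*(((ν ⊗ vol)|_{M × B})·(j ∘ snd))`, `Ψ(p,y) = (p, s(p)·E(y))`,
  `κ` left-invariant s-finite.
* §3 ★ `chartIdentity_restrict_closedBall` — §1 specialised to `S = B̄(0,R) ⊆ D` in a normed space (the shape ✓`skewChart_restrict_image_eq_map` consumes).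
* §4 (appended) ★★ `eq_map_withDensity_of_forall_lintegral` (a change-of-variables FORMULA `∫⁻ F dμ = ∫⁻ F(Ψ z)J(z) dκ` is the identity `μ = Ψ_*(J·κ)`),
  ★★ `restrict_image_eq_map_of_eq_map` ∕ `_of_forall_lintegral` ∕ `_of_measurableEquiv` (GLOBAL identity, `Ψ` injective ⟹ the TUBE identity `μ|_{Ψ(T)} = Ψ_*(J·(κ|_T))`
  = `hchart` of ✓`laplaceMethod_chart_of_tube`).

HONEST FRAMING: generic measure theory; no model object (twistTrace, Haar on SU(2), jets) appears; ⟨24197⟩ `SwapGluedStiffness`, ⟨24196⟩, ⟨22884⟩ stay OPEN;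
no stub ∕ crux ∕ rung ∕ summit is closed; the Yang–Mills mass gap is NOT proved; no summit is proved by a line.  0 definitions, 0 `sorry`, standard axioms.
References: [cite: Helgason2000, Ch. I §1 Thm 1.14 (13) p. 96] (exponential coordinates), [cite: HasenpflugRudolfSprungk2024, §3.1] (skew product), [folklore].
-/

set_option linter.style.longLine false
set_option linter.style.longFile 0
set_option linter.unusedSectionVars false

noncomputable section

open _root_.MeasureTheory _root_.Set _root_.Metric
open scoped _root_.ENNReal

namespace Summit.QuantumFields.YangMills.Theorems.QuantitativeLaplace

/-! ### §1 Restricting a chart identity to a sub-window -/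

section Restrict

variable {V : Type*} [MeasurableSpace V] {Y : Type*} [MeasurableSpace Y] {vol : Measure V} {κ : Measure Y}

/-- ★★ **Restriction of a chart identity.**  If `κ|_{E(D)} = E_*((J·vol)|_D)` and `E` is injective on `D`, then the same identity holds on every measurable
`S ⊆ D` with measurable image: `κ|_{E(S)} = E_*((J·vol)|_S)`.  (Both sides evaluate on a measurable `A` to `∫⁻_{E⁻¹A ∩ S} J dvol`; injectivity on `D` gives
`E⁻¹(E(S)) ∩ D = S`.) [folklore] -/
theorem chartIdentity_restrict {E : V → Y} (hE : Measurable E) {D S : Set V} (hSD : S ⊆ D) (hinj : InjOn E D)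
    (hESm : MeasurableSet (E '' S)) {J : V → ℝ≥0∞}
    (hchart : κ.restrict (E '' D) = ((vol.restrict D).withDensity J).map E) :
    κ.restrict (E '' S) = ((vol.restrict S).withDensity J).map E := by
  have hsub : E '' S ⊆ E '' D := image_mono hSD
  ext A hA
  -- the key set identity
  have hset : E ⁻¹' (A ∩ E '' S) ∩ D = E ⁻¹' A ∩ S := by
    ext x
    simp only [mem_inter_iff, mem_preimage]
    constructor
    · rintro ⟨⟨hxA, ⟨s, hsS, hsx⟩⟩, hxD⟩
      have : s = x := hinj (hSD hsS) hxD hsx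
      exact ⟨hxA, this ▸ hsS⟩
    · rintro ⟨hxA, hxS⟩
      exact ⟨⟨hxA, mem_image_of_mem E hxS⟩, hSD hxS⟩
  rw [Measure.restrict_apply hA,
    show κ (A ∩ E '' S) = κ.restrict (E '' D) (A ∩ E '' S) by
      rw [Measure.restrict_apply (hA.inter hESm), inter_assoc, inter_eq_left.mpr hsub],
    hchart, Measure.map_apply hE (hA.inter hESm), withDensity_apply _ (hE (hA.inter hESm)),
    Measure.restrict_restrict (hE (hA.inter hESm)), hset, Measure.map_apply hE hA, withDensity_apply _ (hE hA),
    Measure.restrict_restrict (hE hA)]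

/-- ★ **Restriction of a chart identity to a closed ball** `B̄(0,R) ⊆ D` of a normed frame space — the shape consumed by
✓`skewChart_restrict_image_eq_map` (`hchart1`) and produced, on the frame ball `D = e⁻¹B(0,s_C∕2)`, by ✓`haar_restrict_window_eq_map_withDensity_frame`. [folklore] -/
theorem chartIdentity_restrict_closedBall {W : Type*} [NormedAddCommGroup W] [MeasurableSpace W] [OpensMeasurableSpace W] {volW : Measure W}
    {E : W → Y} (hE : Measurable E) {D : Set W} {R : ℝ} (hSD : closedBall (0 : W) R ⊆ D) (hinj : InjOn E D)
    (hESm : MeasurableSet (E '' closedBall (0 : W) R)) {J : W → ℝ≥0∞}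
    (hchart : κ.restrict (E '' D) = ((volW.restrict D).withDensity J).map E) :
    κ.restrict (E '' closedBall (0 : W) R) = ((volW.restrict (closedBall (0 : W) R)).withDensity J).map E :=
  chartIdentity_restrict hE hSD hinj hESm hchart

end Restrict

/-! ### §2 The skew-product chart over an arbitrary measurable fibre window -/

section Skew

variable {M : Type*} [MeasurableSpace M] {ν : Measure M} [SFinite ν]
variable {Y : Type*} [Group Y] [MeasurableSpace Y] [MeasurableMul₂ Y] [MeasurableInv Y] {κ : Measure Y} [SFinite κ]
  [κ.IsMulLeftInvariant]
variable {V : Type*} [MeasurableSpace V] {vol : Measure V} [SFinite vol]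

/-- ★★ **The skew-product chart identity over an arbitrary measurable fibre window `B`.**  With `Ψ(p,y) = (p, s(p)·E(y))`, `T = M × B`, a LEFT-INVARIANT
s-finite `κ` on the group `Y`, the one-fibre chart identity `κ|_{E(B)} = E_*((j·vol)|_B)` (`j` measurable, `E(B)` measurable, `E` measurable) and a measurable
section `s`: `(ν ⊗ κ)|_{Ψ(T)} = Ψ_*(((ν ⊗ vol)|_T)·(j ∘ snd))`.  Same proof as ✓`skewChart_restrict_image_eq_map` (the case `B = B̄(0,R)`).
[cite: HasenpflugRudolfSprungk2024, §3.1 Assumption 3 (T)] -/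
theorem skewChart_restrict_image_eq_map_of_measurableSet {E : V → Y} (hE : Measurable E) {s : M → Y} (hs : Measurable s) {B : Set V}
    (hBm : MeasurableSet B) {j : V → ℝ} (hjm : Measurable j) (hEB : MeasurableSet (E '' B))
    (hchart1 : κ.restrict (E '' B) = ((vol.restrict B).withDensity fun y => ENNReal.ofReal (j y)).map E) :
    (ν.prod κ).restrict ((fun z : M × V => ((z.1, s z.1 * E z.2) : M × Y)) '' (univ ×ˢ B)) =
      (((ν.prod vol).restrict (univ ×ˢ B)).withDensity fun z => ENNReal.ofReal (j z.2)).map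
        (fun z : M × V => ((z.1, s z.1 * E z.2) : M × Y)) := by
  set Ψ : M × V → M × Y := fun z => (z.1, s z.1 * E z.2) with hΨdef
  have hΨm : Measurable Ψ := measurable_fst.prodMk ((hs.comp measurable_fst).mul (hE.comp measurable_snd))
  obtain ⟨himg, hTm⟩ := measurableSet_image_skewChart (E := E) hs (B := B) hEB
  have hTm' : MeasurableSet (Ψ '' (univ ×ˢ B)) := hTm
  set g : M × V → ℝ≥0∞ := fun z => ENNReal.ofReal (j z.2) with hgdef
  have hgm : Measurable g := ENNReal.measurable_ofReal.comp (hjm.comp measurable_snd)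
  ext S hS
  -- RIGHT: the pushed-forward weighted product measure, by Tonelli
  have hR : ((((ν.prod vol).restrict (univ ×ˢ B)).withDensity g).map Ψ) S =
      ∫⁻ p, ∫⁻ y in B, (Ψ ⁻¹' S).indicator g (p, y) ∂vol ∂ν := by
    rw [Measure.map_apply hΨm hS, withDensity_apply _ (hΨm hS), ← Measure.prod_restrict, Measure.restrict_univ,
      ← lintegral_indicator (hΨm hS), lintegral_prod _ ((hgm.indicator (hΨm hS)).aemeasurable)]
  -- LEFT: the restricted product measure, section by section, using left-invariance and the one-fibre chart
  have hL : ((ν.prod κ).restrict (Ψ '' (univ ×ˢ B))) S = ∫⁻ p, ∫⁻ y in B, (Ψ ⁻¹' S).indicator g (p, y) ∂vol ∂ν := by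
    rw [Measure.restrict_apply hS, Measure.prod_apply (hS.inter hTm')]
    refine lintegral_congr fun p => ?_
    set W : Set Y := (fun w : Y => ((p, s p * w) : M × Y)) ⁻¹' S with hWdef
    have hWm : MeasurableSet W := (measurable_const.prodMk (measurable_const.mul measurable_id)) hS
    have hsec : Prod.mk p ⁻¹' (S ∩ Ψ '' (univ ×ˢ B)) = (fun z : Y => (s p)⁻¹ * z) ⁻¹' (W ∩ E '' B) := by
      rw [himg]
      ext z
      simp only [mem_preimage, mem_inter_iff, hWdef, mul_inv_cancel_left]
    rw [hsec, measure_preimage_mul κ (s p)⁻¹ (W ∩ E '' B)]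
    rw [show κ (W ∩ E '' B) = κ.restrict (E '' B) W from (Measure.restrict_apply hWm).symm, hchart1,
      Measure.map_apply hE hWm, withDensity_apply _ (hE hWm), Measure.restrict_restrict (hE hWm),
      ← lintegral_indicator ((hE hWm).inter hBm)]
    rw [← lintegral_indicator hBm]
    refine lintegral_congr fun y => ?_
    by_cases hyB : y ∈ B
    · by_cases hyS : Ψ (p, y) ∈ S
      · have h1 : y ∈ E ⁻¹' W ∩ B := ⟨by simpa [hWdef, hΨdef] using hyS, hyB⟩
        rw [indicator_of_mem h1, indicator_of_mem hyB, indicator_of_mem (show (p, y) ∈ Ψ ⁻¹' S from hyS)]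
      · have h1 : y ∉ E ⁻¹' W ∩ B := fun h => hyS (by simpa [hWdef, hΨdef] using h.1)
        rw [indicator_of_notMem h1, indicator_of_mem hyB, indicator_of_notMem (show (p, y) ∉ Ψ ⁻¹' S from hyS)]
    · have h1 : y ∉ E ⁻¹' W ∩ B := fun h => hyB h.2
      rw [indicator_of_notMem h1, indicator_of_notMem hyB]
  rw [hL, hR]

/-- ★ **Skew product over a sub-window of a charted domain** — §1 and §2 composed: from the one-fibre identity on `D` (injective there) to the tube identity over any
measurable `B ⊆ D` with `E(B)` measurable. [folklore] -/
theorem skewChart_restrict_image_eq_map_of_subset {E : V → Y} (hE : Measurable E) {s : M → Y} (hs : Measurable s) {D B : Set V}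
    (hBm : MeasurableSet B) (hBD : B ⊆ D) (hinj : InjOn E D) {j : V → ℝ} (hjm : Measurable j) (hEB : MeasurableSet (E '' B))
    (hchartD : κ.restrict (E '' D) = ((vol.restrict D).withDensity fun y => ENNReal.ofReal (j y)).map E) :
    (ν.prod κ).restrict ((fun z : M × V => ((z.1, s z.1 * E z.2) : M × Y)) '' (univ ×ˢ B)) =
      (((ν.prod vol).restrict (univ ×ˢ B)).withDensity fun z => ENNReal.ofReal (j z.2)).map
        (fun z : M × V => ((z.1, s z.1 * E z.2) : M × Y)) :=
  skewChart_restrict_image_eq_map_of_measurableSet hE hs hBm hjm hEB (chartIdentity_restrict hE hBD hinj hEB hchartD)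

end Skew

/-! ### §4 From a GLOBAL change of variables (as a measure identity or as a `∫⁻` formula) to the tube identity
(appended 2026-08-31 by the same seat: the bridge from a chart given as `∫⁻ F dμ = ∫⁻ F(Ψ z)·J(z) dκ` — the format of ✓`BlowUpRing.lintegral_ringMeasure_eq_gnomonic` —
or as `μ = Ψ_*(J·κ)` with `Ψ` injective (W3's `GnoCoord` fibre∕base `MeasurableEquiv`) to the `hchart` hypothesis of ✓`laplaceMethod_chart_of_tube` ∕
✓`laplaceMethod_quantitative_fibred_chart[_cubic]`) -/

section Global

variable {Z : Type*} [MeasurableSpace Z] {X : Type*} [MeasurableSpace X] {κ : Measure Z} {μ : Measure X}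

/-- ★★ **A change-of-variables FORMULA is a measure identity**: if `∫⁻ F dμ = ∫⁻ F(Ψ z)·J(z) dκ` for every measurable `F ≥ 0` (`Ψ` measurable), then
`μ = Ψ_*(J·κ)`. [folklore] -/
theorem eq_map_withDensity_of_forall_lintegral {Ψ : Z → X} (hΨ : Measurable Ψ) {J : Z → ℝ≥0∞}
    (h : ∀ F : X → ℝ≥0∞, Measurable F → ∫⁻ x, F x ∂μ = ∫⁻ z, F (Ψ z) * J z ∂κ) :
    μ = (κ.withDensity J).map Ψ := by
  ext s hs
  rw [← lintegral_indicator_one hs, h _ (measurable_one.indicator hs), Measure.map_apply hΨ hs, withDensity_apply _ (hΨ hs),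
    ← lintegral_indicator (hΨ hs)]
  refine lintegral_congr fun z => ?_
  by_cases hz : Ψ z ∈ s
  · rw [indicator_of_mem hz, indicator_of_mem (show z ∈ Ψ ⁻¹' s from hz), Pi.one_apply, one_mul]
  · rw [indicator_of_notMem hz, indicator_of_notMem (show z ∉ Ψ ⁻¹' s from hz), zero_mul]

/-- ★★ **GLOBAL identity ⟹ TUBE identity**: `μ = Ψ_*(J·κ)` with `Ψ` measurable and INJECTIVE gives, for every measurable `T` with `Ψ(T)` measurable,
`μ|_{Ψ(T)} = Ψ_*((J·κ)|_T) = Ψ_*(J·(κ|_T))` — the `hchart` of ✓`laplaceMethod_chart_of_tube` (there `κ = ν ⊗ vol`, `T = M × B̄(0,R)`). [folklore] -/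
theorem restrict_image_eq_map_of_eq_map {Ψ : Z → X} (hΨ : Measurable Ψ) (hinj : Function.Injective Ψ) {J : Z → ℝ≥0∞}
    (hμ : μ = (κ.withDensity J).map Ψ) {T : Set Z} (hT : MeasurableSet T) (hΨT : MeasurableSet (Ψ '' T)) :
    μ.restrict (Ψ '' T) = ((κ.restrict T).withDensity J).map Ψ := by
  rw [hμ, Measure.restrict_map hΨ hΨT, hinj.preimage_image, restrict_withDensity hT]

/-- ★★ **Change-of-variables formula ⟹ tube identity** (§4 composed): from `∫⁻ F dμ = ∫⁻ F(Ψ z)·J(z) dκ` for all measurable `F ≥ 0`, `Ψ` measurable injective,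
`T` and `Ψ(T)` measurable: `μ|_{Ψ(T)} = Ψ_*(J·(κ|_T))`. [folklore] -/
theorem restrict_image_eq_map_of_forall_lintegral {Ψ : Z → X} (hΨ : Measurable Ψ) (hinj : Function.Injective Ψ) {J : Z → ℝ≥0∞}
    (h : ∀ F : X → ℝ≥0∞, Measurable F → ∫⁻ x, F x ∂μ = ∫⁻ z, F (Ψ z) * J z ∂κ)
    {T : Set Z} (hT : MeasurableSet T) (hΨT : MeasurableSet (Ψ '' T)) :
    μ.restrict (Ψ '' T) = ((κ.restrict T).withDensity J).map Ψ :=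
  restrict_image_eq_map_of_eq_map hΨ hinj (eq_map_withDensity_of_forall_lintegral hΨ h) hT hΨT

/-- ★ **`MeasurableEquiv` form**: for `e : Z ≃ᵐ X` with `μ = e_*(J·κ)`, every measurable `T` has `e(T)` measurable and `μ|_{e(T)} = e_*(J·(κ|_T))`. [folklore] -/
theorem restrict_image_eq_map_of_measurableEquiv (e : Z ≃ᵐ X) {J : Z → ℝ≥0∞} (hμ : μ = (κ.withDensity J).map e) {T : Set Z} (hT : MeasurableSet T) :
    MeasurableSet (e '' T) ∧ μ.restrict (e '' T) = ((κ.restrict T).withDensity J).map e :=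
  ⟨e.measurableEmbedding.measurableSet_image.2 hT,
    restrict_image_eq_map_of_eq_map e.measurable e.injective hμ hT (e.measurableEmbedding.measurableSet_image.2 hT)⟩

end Global

end Summit.QuantumFields.YangMills.Theorems.QuantitativeLaplace

end
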